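import Mathlib
import HarnessLib
import Summits.AnomalousDissipation.AnomalousDissipation.Theses.MomentParity
import Literature.Analysis.FluidPDE.StatisticalSolution
import Literature.Analysis.FluidPDE.StokesTorus

/-!
# Sketch — crux-ideate stmt-AnomalousDissipation-14283 (MomentParity.GalerkinInvariantLoud), ideator 1, round 1

First lemmas of the two idea cards `galerkin-limit-work-functional` and
`symmetrised-shear-profile-law`, stated over existing declarations. Targets are `def … : Prop`
(to be proved by the line); small structural lemmas are proved here when cheap.
-/

noncomputable section

open MeasureTheory Filter Topology
open scoped InnerProductSpace RealInnerProductSpace ENNReal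

namespace Summit.AnomalousDissipation.AnomalousDissipation.Cruxes.GalerkinInvariantLoud.Ideator1

open Literature.Analysis.FunctionSpaces Literature.Analysis.FluidPDE

/-- The flat unit three-torus. -/
abbrev T3 := UnitAddTorus (Fin 3)
/-- Velocity values. -/
abbrev E3 := EuclideanSpace ℝ (Fin 3)
/-- The energy space `H` of FMRT (closed subspace of `L²(T³;ℝ³)`). -/
abbrev H := Torus.energySpace (Fin 3)

/-- `g` is carried by the Fourier–Galerkin level `N` (all coefficients off `0 < |k| ≤ N` vanish). -/
def IsLevel (N : ℕ) (g : T3 → E3) : Prop :=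
  ∀ k ∉ (Torus.freqBall N).erase (0 : Fin 3 → ℤ),
    UnitAddTorus.mFourierCoeff (Literature.Analysis.FunctionSpaces.EuclideanSpace.complexify ∘ g) k = 0

/-- Admissible band-limited smooth solenoidal test field at level `N` (the GIL test class). -/
def IsTestField (N : ℕ) (g : T3 → E3) : Prop :=
  Torus.IsSmooth g ∧ Torus.IsDivFree g ∧ Torus.HasZeroMean g ∧ IsLevel N g

/-- The gradient field `∇p(u) = Σᵢ ∂ᵢP((u,g₁),…,(u,gₘ)) gᵢ` of a polynomial cylindrical observable. -/
def polyTest (m : ℕ) (g : Fin m → T3 → E3) (P : MvPolynomial (Fin m) ℝ) (u : H) : T3 → E3 :=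
  fun x => ∑ i : Fin m,
    (MvPolynomial.eval (fun j => Torus.pairing u.1 (g j)) (MvPolynomial.pderiv i P)) • g i x

/-- Stationarity of `μ` for level-`N` Galerkin NS at `(ν,f)` against all polynomial cylindrical
band-limited observables (the GIL stationarity clause, verbatim in content). -/
def IsPolyStationary (ν : ℝ) (f : T3 → E3) (N : ℕ) (μ : Measure H) : Prop :=
  ∀ (m : ℕ) (g : Fin m → T3 → E3) (P : MvPolynomial (Fin m) ℝ), (∀ i, IsTestField N (g i)) →
    Integrable (fun u => Torus.nsGeneratorPairing ν f u (polyTest m g P u)) μ ∧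
      ∫ u, Torus.nsGeneratorPairing ν f u (polyTest m g P u) ∂μ = 0

/-- The inner body of `GalerkinInvariantLoud` at one `(ν, f, N, R, E, ε)`: a GIL WITNESS. -/
def IsWitness (ν : ℝ) (f : T3 → E3) (N : ℕ) (R E ε : ℝ) (μ : Measure H) : Prop :=
  IsProbabilityMeasure μ ∧ (∀ᵐ u ∂μ, IsLevel N (u.1 : T3 → E3)) ∧ (∀ᵐ u ∂μ, ‖u‖ ≤ R) ∧
    IsPolyStationary ν f N μ ∧ Torus.ensembleEnergy μ ≤ E ∧ ε ≤ Torus.ensembleDissipation ν μ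

/-- GIL rewritten through `IsWitness` (same quantifier prefix as the route decl). -/
def GILviaWitness : Prop :=
  ∃ f : T3 → E3, Torus.IsSmooth f ∧ Torus.IsDivFree f ∧ Torus.HasZeroMean f ∧
    ∃ (ν : ℕ → ℝ) (E ε : ℝ), (∀ j, 0 < ν j) ∧ Tendsto ν atTop (𝓝 0) ∧ 0 < ε ∧
      ∀ j : ℕ, ∃ R : ℝ, ∃ᶠ N in atTop, ∃ μ : Measure H, IsWitness (ν j) f N R E ε μ

/-- The route decl IS `GILviaWitness` (definitional unfolding; checked). -/
theorem galerkinInvariantLoud_iff_viaWitness :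
    Summit.AnomalousDissipation.AnomalousDissipation.Theses.MomentParity.GalerkinInvariantLoud ↔
      GILviaWitness :=
  Iff.rfl

/-- Degree-one poly-stationarity = drift-freeness of every admissible test field (checked). -/
theorem linearTests_of_isPolyStationary {ν : ℝ} {f : T3 → E3} {N : ℕ} {μ : Measure H}
    (h : IsPolyStationary ν f N μ) {g : T3 → E3} (hg : IsTestField N g) :
    ∫ u, Torus.nsGeneratorPairing ν f u g ∂μ = 0 := by
  have key := (h 1 (fun _ => g) (MvPolynomial.X 0) (fun _ => hg)).2
  have hpt : ∀ u : H, polyTest 1 (fun _ => g) (MvPolynomial.X 0) u = g := by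
    intro u
    funext x
    simp [polyTest]
  simpa [hpt] using key

/-! ## Card `galerkin-limit-work-functional` -/

/-- The WORK FUNCTIONAL `W_f(μ) = ∫ (u, f) dμ = (f, ū_μ)`: the work of the force on the Bochner
mean flow. On GIL witnesses it EQUALS the ensemble dissipation (energy test `|P_N u|²`). -/
def work (f : T3 → E3) (μ : Measure H) : ℝ :=
  ∫ u, Torus.pairing u.1 f ∂μ

/-- (provable now; the refuter's `dissipation_eq`) dissipation = work on every GIL witness. -/
def DissipationEqWork : Prop :=
  ∀ (ν : ℝ) (f : T3 → E3) (N : ℕ) (R E ε : ℝ) (μ : Measure H), 0 < ν → Torus.IsSmooth f →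
    Torus.IsDivFree f → Torus.HasZeroMean f → IsWitness ν f N R E ε μ →
      Torus.ensembleDissipation ν μ = work f μ

/-- FIRST LEMMA of the card (provable now, one line after `DissipationEqWork`): the N-UNIFORM
ENSTROPHY BOUND at fixed viscosity, `∫‖∇u‖² dμ ≤ ‖f‖₂ R / ν`, for every bounded-support invariant
level-`N` measure. It is the load-bearing input of the H¹-tightness / energy-continuity step that
discharges `∃ᶠ N`. -/
def EnstrophyBound : Prop :=
  ∀ (ν : ℝ) (f : T3 → E3) (N : ℕ) (R E ε : ℝ) (μ : Measure H), 0 < ν → Torus.IsSmooth f →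
    Torus.IsDivFree f → Torus.HasZeroMean f → IsWitness ν f N R E ε μ →
      (Torus.ensembleEnstrophy μ).toReal ≤ (eLpNorm f 2 (volume : Measure T3)).toReal * R / ν

/-- `μ` is a GALERKIN-LIMIT stationary statistics of NS_ν(f) with support radius `R`: a narrow limit
(against bounded continuous observables of `H`, strong topology) of bounded-support,
poly-stationary level-`N_k` probability measures with `N_k → ∞` (Vishik–Fursikov / FMRT IV). -/
def IsGalerkinLimit (ν : ℝ) (f : T3 → E3) (R : ℝ) (μ : Measure H) : Prop :=
  IsProbabilityMeasure μ ∧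
    ∃ (Nk : ℕ → ℕ) (μk : ℕ → Measure H), Tendsto Nk atTop atTop ∧
      (∀ k, IsProbabilityMeasure (μk k) ∧ (∀ᵐ u ∂(μk k), IsLevel (Nk k) (u.1 : T3 → E3)) ∧
        (∀ᵐ u ∂(μk k), ‖u‖ ≤ R) ∧ IsPolyStationary ν f (Nk k) (μk k)) ∧
      ∀ Ψ : H → ℝ, Continuous Ψ → Bornology.IsBounded (Set.range Ψ) →
        Tendsto (fun k => ∫ u, Ψ u ∂(μk k)) atTop (𝓝 (∫ u, Ψ u ∂μ))

/-- GIL∞ — the crux with `∃ᶠ N` DISCHARGED: at each viscosity one Galerkin-limit statistics with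
energy `< E` and work `> ε` (strict inequalities: the room needed to pull back to finite `N`). -/
def GILInfty : Prop :=
  ∃ f : T3 → E3, Torus.IsSmooth f ∧ Torus.IsDivFree f ∧ Torus.HasZeroMean f ∧
    ∃ (ν : ℕ → ℝ) (E ε : ℝ), (∀ j, 0 < ν j) ∧ Tendsto ν atTop (𝓝 0) ∧ 0 < ε ∧
      ∀ j : ℕ, ∃ (R : ℝ) (μ : Measure H), IsGalerkinLimit (ν j) f R μ ∧
        Torus.ensembleEnergy μ < E ∧ ε < work f μ

/-- TRANSFER (the card's main claim, provable now, size M–L): GIL ⟺ GIL∞. `→`: diagonal limit,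
energy is continuous along `N → ∞` by `EnstrophyBound` + Rellich (tightness in the norm of `H`),
work is continuous (linear, bounded on the ball); `←`: the approximating level-`N_k` measures
themselves are witnesses for `k` large (same continuity, strict inequalities). -/
def GILTransfer : Prop :=
  Summit.AnomalousDissipation.AnomalousDissipation.Theses.MomentParity.GalerkinInvariantLoud ↔ GILInfty

/-- On Galerkin limits the work DOMINATES the ensemble dissipation (lower semicontinuity of the
mean enstrophy; equality iff no enstrophy leaks at the cutoff = crux `ResolvedDissipation`). -/
def WorkGeDissipationOnLimits : Prop :=
  ∀ (ν : ℝ) (f : T3 → E3) (R : ℝ) (μ : Measure H), 0 < ν → Torus.IsSmooth f →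
    IsGalerkinLimit ν f R μ → Torus.ensembleDissipation ν μ ≤ work f μ

/-- MEAN-SHEAR FLOOR (provable now modulo Bochner bookkeeping, size M): every GIL witness carries a
mean flow `ū` with `ε ≤ ν‖∇ū‖² + E·‖∇ū‖_∞` — production `Π = ν⟨‖∇u′‖²⟩ = −∫τ′:∇ū ≤ ‖∇ū‖_∞ ∫tr τ′`.
Stated for any smooth representative `ubar` of the Bochner mean (characterised by its pairings). -/
def MeanShearFloor : Prop :=
  ∀ (ν : ℝ) (f : T3 → E3) (N : ℕ) (R E ε : ℝ) (μ : Measure H) (ubar : T3 → E3), 0 < ν →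
    Torus.IsSmooth f → Torus.IsDivFree f → Torus.HasZeroMean f → IsWitness ν f N R E ε μ →
    Torus.IsSmooth ubar → (∀ g : T3 → E3, IsTestField N g →
      ∫ u, Torus.pairing u.1 g ∂μ = ∫ x, ⟪ubar x, g x⟫_ℝ) →
      ε ≤ ν * (Torus.eGradNormSq ubar).toReal + E * ⨆ x : T3, ‖Torus.fderiv ubar x‖

/-! ## Card `symmetrised-shear-profile-law` (Kolmogorov family of forces) -/

/-- The Kolmogorov force of wavenumber `m`: `f_K(x) = sin(2π m x₁) e₀` (a Stokes eigenfield of the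
shell `4π²m²`, smooth, divergence-free, mean-zero). -/
def kolForce (m : ℕ) : T3 → E3 :=
  fun x => Torus.stokesMode (Pi.single (1 : Fin 3) (m : ℤ)) (EuclideanSpace.single (0 : Fin 3) (1 : ℝ))
    false x

/-- Its strain partner `c_m(x) = cos(2π m x₁) e₀` (same shell; `τ₀₁` is tested against it). -/
def kolCos (m : ℕ) : T3 → E3 :=
  fun x => Torus.stokesMode (Pi.single (1 : Fin 3) (m : ℤ)) (EuclideanSpace.single (0 : Fin 3) (1 : ℝ))
    true x

/-- Degree-one specialisation of poly-stationarity (provable now, a `simp` away from the GIL clause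
with `m = 1`, `P = X 0`): every admissible test field is drift-free in mean. -/
def LinearTests : Prop :=
  ∀ (ν : ℝ) (f : T3 → E3) (N : ℕ) (μ : Measure H) (g : T3 → E3), IsPolyStationary ν f N μ →
    IsTestField N g → ∫ u, Torus.nsGeneratorPairing ν f u g ∂μ = 0

/-- STRESS PINNING for Kolmogorov forcing (provable now from `LinearTests`, `m ≤ N`): the mean
Reynolds stress against the strain of the force is pinned to `−|f|² + 4π²m²ν·W`, and against the
cosine partner to `4π²m²ν·(ū, c_m)`; i.e. the `x₁`-profile of `τ₀₁` is `−cos(2πm x₁)/(2πm) + νU′ + c`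
— the stress ALWAYS screens the force at leading order; loudness is the first-order defect. -/
def StressPinning : Prop :=
  ∀ (ν : ℝ) (m N : ℕ) (R E ε : ℝ) (μ : Measure H), 0 < ν → 1 ≤ m → m ≤ N →
    IsWitness ν (kolForce m) N R E ε μ →
      (∫ u, Torus.inertialPairing u.1 (kolForce m) ∂μ =
          -(∫ x, ⟪kolForce m x, kolForce m x⟫_ℝ) + 4 * Real.pi ^ 2 * (m : ℝ) ^ 2 * ν * work (kolForce m) μ) ∧
      (∫ u, Torus.inertialPairing u.1 (kolCos m) ∂μ =
          4 * Real.pi ^ 2 * (m : ℝ) ^ 2 * ν * ∫ u, Torus.pairing u.1 (kolCos m) ∂μ)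

/-- TRANSLATION COVARIANCE of the witness predicate (provable now, bookkeeping): pushing a witness
forward under translation by `a` gives a witness for the translated force. For `f = kolForce m`
and `a 1 = 0` (translations in `x₀, x₂`) the force is fixed, so witnesses can be AVERAGED over the
2-torus of such translations (and over the reflection `x₂ ↦ −x₂, u₂ ↦ −u₂` and the shift-reflect
symmetry) without changing energy or dissipation: WLOG the Bochner mean flow is a shear profile
`U(x₁) e₀`. -/
def TranslationCovariance : Prop :=
  ∀ (ν : ℝ) (f : T3 → E3) (N : ℕ) (R E ε : ℝ) (a : T3) (T : H → H) (μ : Measure H),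
    Measurable T → (∀ u : H, ((T u).1 : T3 → E3) =ᵐ[volume] fun x => (u.1 : T3 → E3) (x - a)) →
      IsWitness ν f N R E ε μ → IsWitness ν (fun x => f (x - a)) N R E ε (μ.map T)

/-- SYMMETRIC REDUCTION (provable now from `TranslationCovariance` + Haar averaging over the closed
subgroup `{a : a 1 = 0}` ≅ T², size M): for Kolmogorov forcing, GIL witnesses exist iff
translation-symmetric ones exist (same `ν, N, R, E, ε`). -/
def SymmetricReduction : Prop :=
  ∀ (ν : ℝ) (m N : ℕ) (R E ε : ℝ), (∃ μ, IsWitness ν (kolForce m) N R E ε μ) →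
    ∃ μ : Measure H, IsWitness ν (kolForce m) N R E ε μ ∧
      ∀ (a : T3) (T : H → H), a 1 = 0 → Measurable T →
        (∀ u : H, ((T u).1 : T3 → E3) =ᵐ[volume] fun x => (u.1 : T3 → E3) (x - a)) → μ.map T = μ

/-- THE 1-D PROFILE LAW, typed as the specialisation of `MeanShearFloor` to SHEAR-PROFILE mean
flows (what symmetric witnesses have): if the Bochner mean of a Kolmogorov witness is represented
by a smooth field `Ubar` depending on `x₁` only and pointing along `e₀` (`Ubar = U(x₁) e₀`), then
`ε ≤ ν‖U′‖² + E‖U′‖_∞`. Informal companion (the card): `νU″ − τ₀₁′ + sin(2πm x₁) = 0`, so LOUD ⟺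
`Û(m) ≥ 2ε` ⟺ the eddy viscosity `ν_T := −τ₀₁/U′` of the mean profile stays bounded. -/
def ShearProfileFloor : Prop :=
  ∀ (ν : ℝ) (m N : ℕ) (R E ε : ℝ) (μ : Measure H) (Ubar : T3 → E3), 0 < ν → 1 ≤ m → m ≤ N →
    IsWitness ν (kolForce m) N R E ε μ → Torus.IsSmooth Ubar →
    (∀ x y : T3, x 1 = y 1 → Ubar x = Ubar y) → (∀ x : T3, Ubar x 1 = 0 ∧ Ubar x 2 = 0) →
    (∀ g : T3 → E3, IsTestField N g → ∫ u, Torus.pairing u.1 g ∂μ = ∫ x, ⟪Ubar x, g x⟫_ℝ) →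
      ε ≤ ν * (Torus.eGradNormSq Ubar).toReal + E * ⨆ x : T3, ‖Torus.fderiv Ubar x‖

end Summit.AnomalousDissipation.AnomalousDissipation.Cruxes.GalerkinInvariantLoud.Ideator1

end
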